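import Summits.QuantumFields.QCD.Theorems.PauliWegnerSeaChiralGluonicCompletionDefs
import Summits.QuantumFields.QCD.Theorems.WilsonMobilityGapChiralMobilityGapSketchDefs

/-!
# Stub `stub_fmChiral_of_vanishingRate_two` of line `Sketch` (crux `ChiralGluonicCompletion`, stmt-QuantumFields-17498)

FM-chirality from the vanishing chiral rate (`N_f = 2`, pure unfolding).  The VANISHING CHIRAL RATE of a two-flavour
regularisation (crux 17497's `ChiralMobilityGapSketch.VanishingChiralRate`: for every `ε > 0` a positive mass `t` and
clause-(iii) constants `0 < s < 1`, `c₀ > 0`, `C₁`, `p` with `2C₁ < sε` such that clause (iii) — the `|det|`-weighted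
fractional-moment LOWER bound on the quark propagator along the time axis, ALL flavours, all tori `S ≥ L_k`, all
`n ≤ S`, eventually in `k` — holds at the degenerate tuple `(t,t)`) gives the FM-chirality hypothesis of the landed Jensen
bridge `stub_secondMoment_of_fmChiral_two` (ONE flavour, `0 < s ≤ 2`, the functional written out): unfold
`LowerWith` / `MobilityGapNegative.fm` / `bare` (all definitional) and specialise the flavour to `0`.  Folklore bookkeeping.
-/

noncomputable section

namespace Summit.QuantumFields.QCD.Theorems.StronglyChiralSubsequence

open MeasureTheory Filter Topology
open Literature.MathematicalPhysics.QuantumFieldTheory Literature.MathematicalPhysics.QuantumLattice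
  Literature.Probability.LatticeModels
open Summit.QuantumFields.QCD.Theorems.MobilityGapNegative (bare fm)
open Summit.QuantumFields.QCD.Theorems.ChiralMobilityGapSketch (VanishingChiralRate)

/-- **FM-chirality from the vanishing chiral rate** (`N_f = 2`): clause (iii) at degenerate tuples with physical rate
`2C₁/s < ε` for every `ε` (all flavours, `s < 1`) gives, flavour `0` and `s ≤ 2`, the eventual `|det|`-weighted
fractional-moment lower bound consumed by `stub_secondMoment_of_fmChiral_two` — by unfolding. [folklore] -/
theorem stub_fmChiral_of_vanishingRate_two : ∀ reg : QCDRegularisation 2, VanishingChiralRate reg → ∀ ε : ℝ, 0 < ε → ∃ m : ℝ, 0 < m ∧ ∃ (f : Fin 2) (s c₀ C₁ p : ℝ), 0 < s ∧ s ≤ 2 ∧ 0 < c₀ ∧ 2 * C₁ < s * ε ∧ ∀ᶠ k in atTop, ∀ S : ℕ, reg.L k ≤ S → ∀ n : ℕ, n ≤ S → c₀ * Real.exp (-(C₁ * (reg.a k * n) + p * Real.log (n + 1))) ≤ (∫ U : GaugeConfig 4 (2 * S + 1) (Matrix.specialUnitaryGroup (Fin 3) ℂ), ‖(diracMatrix U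 fun _ : Fin 2 => reg.mcrit k + reg.a k * m / reg.Zm k).det‖ * (∑ a : Fin 3, ∑ i : Fin 4, ∑ b : Fin 3, ∑ j : Fin 4, ‖(diracMatrix U fun _ : Fin 2 => reg.mcrit k + reg.a k * m / reg.Zm k)⁻¹ (quarkEquiv (f, (Torus.proj (2 * S + 1) 0, a, i))) (quarkEquiv (f, (Torus.proj (2 * S + 1) (Pi.single 0 (n : ℤ)), b, j)))‖) ^ s ∂(wilsonMeasure (fundamentalRep (Fin 3)) (reg.β k))) / (∫ U : GaugeConfig 4 (2 * S + 1) (Matrix.specialUnitaryGroup (Fin 3) ℂ), ‖(diracMatrix U fun _ : Fin 2 => reg.mcrit k + reg.a k * m / reg.Zm k).det‖ ∂(wilsonMeasure (fundamentalRep (Fin 3)) (reg.β k))) := by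
  intro reg hV ε hε
  obtain ⟨t, ht, s, c₀, C₁, p, hs, hs1, hc₀, hC, hL⟩ := hV ε hε
  refine ⟨t, ht, 0, s, c₀, C₁, p, hs, by linarith, hc₀, hC, ?_⟩
  filter_upwards [hL] with k hk S hS n hn
  exact hk S hS 0 n hn

end Summit.QuantumFields.QCD.Theorems.StronglyChiralSubsequence

end
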